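import Literature.Topology.FourManifolds.LatticeFormsSpecialOrthogonalHyperbolicSum
import HarnessLib

/-!
# Lemma 3.2 in the standard model: `SO⁺(U ⊕ U) = E_{U_i}`, and `SO⁺(U^{⊕n}) = E_{U_i}` for ALL `n ≥ 2`, every plane, every
# hyperbolic pair of every lattice `L ≅ U^{⊕n}` (the genus `II_{n,n}`, `n ≥ 2`)
# (Gritsenko–Hulek–Sankaran, *J. Algebra* 322 (2009), §3.2 Lemma 3.2, (14), Prop. 3.3 (iii), Prop. 3.4 (15))

Trunk T-4MAN vocabulary. Row g49-#4 proved Lemma 3.2 — `SO⁺(U ⊕ U₁) = E_U(U₁)` — in the nested model `H ⊕ H` at the outer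
pair, and row g50-#1 proved `SO⁺(U^{⊕n}) = E_{U_i}` in `hyperbolicSum n` for `n ≥ 3` (the bound coming from its `3U` base). This
file supplies the base `n = 2` in the standard model `hyperbolicSum 2` (both planes; `H ⊕ H ≅ hyperbolicSum 2` aligned so that the
outer pair goes to `(e_i, f_i)`, words transported by (t4)), and repackages everything for ALL `n ≥ 2`: in `hyperbolicSum n`
at every plane, for every lattice isometric to `U^{⊕n}` at every hyperbolic pair, and hypothesis-style for every even unimodular
lattice of rank `2n` and signature `0`. Written for lane `lit-hodgefound` (Track 2 foundations; prover seat `lit-hodgefound-p18`,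
gen 50, row g50-#5). THEOREMS ONLY — no definition, no named fact, no instance, no notation.

## Source, verbatim (held text `paper:arxiv-0810.1614`)

* §3.2 p. 6: "**Lemma 3.2.** `SO⁺(U ⊕ U₁)` is generated by the four transvections `t(e,e₁)`, `t(e,f₁)`, `t(f,e₁)` and `t(f,f₁)`."
  and (14): "`SO⁺(U ⊕ U₁) = E_U(U₁)`, where `E_U(U₁)` is the group generated by these four elements";
* §3.3 p. 7: "(iii) `O(L) = ⟨E_U(L₁), O(L₁)⟩` […] similarly for `SO`, `S̃O`, etc.."; (15): "`S̃O⁺(L) = O′(L) = E(L) = E_U(L₁)`".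

## Contents (all proved)

* §1 `H ⊕ H ≅ U^{⊕2}` (`nonempty_isometryEquiv_twoU_hyperbolicSum`), aligned (`exists_isometryEquiv_twoU_hyperbolicSum_apply_eq`);
  **Lemma 3.2 in `hyperbolicSum 2` at either plane** (`hyperbolicSum_two_exists_uGens_eq_of_isOrientationPreserving_of_det_eq_one`).
* §2 **all `n ≥ 2`**: `SO⁺(U^{⊕n}) ⊆ E_{U_i}` (`hyperbolicSum_exists_uGens_eq_of_isOrientationPreserving_of_det_eq_one_of_two_le`),
  `SO⁺(U^{⊕n}) = E_{U_i}` as an iff (`hyperbolicSum_isOrientationPreserving_and_det_eq_one_iff_exists_uGens_of_two_le`).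
* §3 model-free for every `L ≅ U^{⊕n}`, `n ≥ 2`, at every hyperbolic pair, and the genus `II_{n,n}`, `n ≥ 2`.
-/

noncomputable section

open Module
open LinearMap (BilinForm)
open LinearMap.BilinForm
open LinearMap.BilinForm (IsometryEquiv)

namespace Literature.Topology.FourManifolds

/-! ### §1 `n = 2`: Lemma 3.2 in the standard model `hyperbolicSum 2` -/

section Two

/-- **`H ⊕ H ≅ U^{⊕2}`** (both even unimodular of rank `4` and signature `0`). [cite: Huybrechts2016K3, Ch. 14 Cor. 1.3 (i)] [cite: GritsenkoHulekSankaran2009, §3.2 ("U ⊕ U₁")] -/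
theorem nonempty_isometryEquiv_twoU_hyperbolicSum :
    Nonempty ((hyperbolicForm.prod hyperbolicForm).IsometryEquiv (hyperbolicSum 2)) := by
  have hH := isSymm_hyperbolicForm
  have hu : (hyperbolicForm.prod hyperbolicForm).IsUnimodular :=
    isUnimodular_prod_iff.2 ⟨isUnimodular_hyperbolicForm_holds, isUnimodular_hyperbolicForm_holds⟩
  have hsig : (hyperbolicForm.prod hyperbolicForm).signature = 0 := by
    rw [signature_prod _ _ hH hH]
    have h0 : hyperbolicForm.signature = 0 := signature_hyperbolicForm_holds
    rw [h0, add_zero]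
  have hrank : finrank ℤ ((Fin 2 → ℤ) × (Fin 2 → ℤ)) = 2 * 2 := by simp
  exact equivalent_hyperbolicSum_of_signature_eq_zero _ (hH.prod hH) hu (isEven_prod_hyperbolic isEven_hyperbolicForm)
    (by norm_num) hrank hsig

/-- **Aligned model isometry `H ⊕ H ⥲ U^{⊕2}`** sending the outer pair `(x, y)` to the plane `(e_i, f_i)`.
[cite: GritsenkoHulekSankaran2009, Prop. 3.3 (iii), proof] [cite: Huybrechts2016K3, Ch. 14 Cor. 1.3 (i)] -/
theorem exists_isometryEquiv_twoU_hyperbolicSum_apply_eq (i : Fin 2) :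
    ∃ e : (hyperbolicForm.prod hyperbolicForm).IsometryEquiv (hyperbolicSum 2),
      e hypX = (Pi.single i 1, 0) ∧ e hypY = (0, Pi.single i 1) := by
  obtain ⟨e₀⟩ := nonempty_isometryEquiv_twoU_hyperbolicSum
  obtain ⟨j, hj⟩ : ∃ j : Fin 2, i ≠ j := by
    by_cases hi : i = 0
    · exact ⟨1, by rw [hi]; decide⟩
    · exact ⟨0, hi⟩
  have hu : hyperbolicSum 2 (e₀ hypX) (e₀ hypX) = 0 := by rw [e₀.map_app, prod_hyperbolic_hypX_hypX]
  have huz : hyperbolicSum 2 (e₀ hypX) (e₀ hypY) = 1 := by rw [e₀.map_app, prod_hyperbolic_hypX_hypY]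
  have hz : hyperbolicSum 2 (e₀ hypY) (e₀ hypY) = 0 := by rw [e₀.map_app, prod_hyperbolic_hypY_hypY]
  obtain ⟨g, hgu, hgz⟩ := hyperbolicSum_exists_isometryEquiv_apply_eq_single hj hu huz hz
  exact ⟨e₀.trans g, by rw [LinearMap.BilinForm.IsometryEquiv.trans_apply, hgu],
    by rw [LinearMap.BilinForm.IsometryEquiv.trans_apply, hgz]⟩

/-- **Lemma 3.2 in the standard model: `SO⁺(U^{⊕2}) ⊆ E_{U_i}`** at either plane `i` — every isometry of `hyperbolicSum 2` in `O⁺`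
with determinant `1` is an admissible word in the transvections `t(f_i, a)`, `t(e_i, a)`, `a ⊥ e_i, f_i` (row g49-#4's nested-model
Lemma 3.2 transported along an aligned isometry). [cite: GritsenkoHulekSankaran2009, §3.2 Lemma 3.2 and (14)] -/
theorem hyperbolicSum_two_exists_uGens_eq_of_isOrientationPreserving_of_det_eq_one (i : Fin 2)
    (φ : (hyperbolicSum 2).IsometryEquiv (hyperbolicSum 2)) (h₁ : φ.IsOrientationPreserving)
    (h₂ : LinearMap.det (φ : (Fin 2 → ℤ) × (Fin 2 → ℤ) →ₗ[ℤ] (Fin 2 → ℤ) × (Fin 2 → ℤ)) = 1) :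
    ∃ l : List (UGen ((Fin 2 → ℤ) × (Fin 2 → ℤ))),
      (∀ g ∈ l, g.IsAdmissible (hyperbolicSum 2) (Pi.single i 1, 0) (0, Pi.single i 1)) ∧
      ∀ v, φ v = UGen.eval (hyperbolicSum 2) (Pi.single i 1, 0) (0, Pi.single i 1) l v := by
  obtain ⟨e, hx, hy⟩ := exists_isometryEquiv_twoU_hyperbolicSum_apply_eq i
  obtain ⟨l, hl, hlv⟩ := exists_uGens_eq_of_isometryEquiv_of_forall e
    (fun ψ hψ₁ hψ₂ ↦ exists_uGens_eq_of_isOrientationPreserving_of_det_eq_one ψ hψ₁ hψ₂) φ h₁ h₂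
  rw [hx, hy] at hl hlv
  exact ⟨l, hl, hlv⟩

end Two

/-! ### §2 All `n ≥ 2` in the standard model -/

section TwoLe

/-- **`SO⁺(U^{⊕n}) ⊆ E_{U_i}(U_i^⊥)` for ALL `n ≥ 2` and every plane** (Lemma 3.2 for `n = 2`, (15) for `n ≥ 3`).
[cite: GritsenkoHulekSankaran2009, §3.2 Lemma 3.2, Prop. 3.4 (15) and §3.3 (remark after Prop. 3.3)] -/
theorem hyperbolicSum_exists_uGens_eq_of_isOrientationPreserving_of_det_eq_one_of_two_le {n : ℕ} (hn : 2 ≤ n) (i : Fin n)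
    (φ : (hyperbolicSum n).IsometryEquiv (hyperbolicSum n)) (h₁ : φ.IsOrientationPreserving)
    (h₂ : LinearMap.det (φ : (Fin n → ℤ) × (Fin n → ℤ) →ₗ[ℤ] (Fin n → ℤ) × (Fin n → ℤ)) = 1) :
    ∃ l : List (UGen ((Fin n → ℤ) × (Fin n → ℤ))),
      (∀ g ∈ l, g.IsAdmissible (hyperbolicSum n) (Pi.single i 1, 0) (0, Pi.single i 1)) ∧
      ∀ v, φ v = UGen.eval (hyperbolicSum n) (Pi.single i 1, 0) (0, Pi.single i 1) l v := by
  rcases Nat.lt_or_ge n 3 with h | h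
  · obtain rfl : n = 2 := by omega
    exact hyperbolicSum_two_exists_uGens_eq_of_isOrientationPreserving_of_det_eq_one i φ h₁ h₂
  · exact hyperbolicSum_exists_uGens_eq_of_isOrientationPreserving_of_det_eq_one h i φ h₁ h₂

/-- **`SO⁺(U^{⊕n}) = E_{U_i}(U_i^⊥)` for ALL `n ≥ 2`, as an iff**: in `O⁺` with determinant `1` iff an admissible word at the plane
`(e_i, f_i)`. [cite: GritsenkoHulekSankaran2009, §3.2 (14), Prop. 3.4 (15) and §3.1 (8)] -/
theorem hyperbolicSum_isOrientationPreserving_and_det_eq_one_iff_exists_uGens_of_two_le {n : ℕ} (hn : 2 ≤ n) (i : Fin n)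
    (φ : (hyperbolicSum n).IsometryEquiv (hyperbolicSum n)) :
    (φ.IsOrientationPreserving ∧ LinearMap.det (φ : (Fin n → ℤ) × (Fin n → ℤ) →ₗ[ℤ] (Fin n → ℤ) × (Fin n → ℤ)) = 1) ↔
      ∃ (L : List (UGen ((Fin n → ℤ) × (Fin n → ℤ))))
        (hL : ∀ g ∈ L, g.IsAdmissible (hyperbolicSum n) (Pi.single i 1, 0) (0, Pi.single i 1)),
        φ = UGen.evalEquiv (isSymm_hyperbolicSum n) (hyperbolicSum_inl_inl n (Pi.single i 1) (Pi.single i 1))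
          (hyperbolicSum_inr_inr n (Pi.single i 1) (Pi.single i 1)) L hL := by
  constructor
  · rintro ⟨h₁, h₂⟩
    obtain ⟨L, hL, hφ⟩ := hyperbolicSum_exists_uGens_eq_of_isOrientationPreserving_of_det_eq_one_of_two_le hn i φ h₁ h₂
    exact ⟨L, hL, DFunLike.ext _ _ fun v ↦ by rw [hφ, UGen.evalEquiv_apply]⟩
  · rintro ⟨L, hL, rfl⟩
    exact (UGen.evalEquiv_mem_stableSpecialOrthogonal (isSymm_hyperbolicSum n) (isUnimodular_hyperbolicSum n).nondegenerate
      _ _ L hL).2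

/-- **The plane does not matter, `n ≥ 2`**: an admissible word at `(e_i, f_i)` is (pointwise) an admissible word at `(e_j, f_j)`.
[cite: GritsenkoHulekSankaran2009, Prop. 3.3 (ii) and (14)–(15)] -/
theorem hyperbolicSum_exists_uGens_eq_uGens_of_two_le {n : ℕ} (hn : 2 ≤ n) (i j : Fin n)
    (L : List (UGen ((Fin n → ℤ) × (Fin n → ℤ))))
    (hL : ∀ g ∈ L, g.IsAdmissible (hyperbolicSum n) (Pi.single i 1, 0) (0, Pi.single i 1)) :
    ∃ l : List (UGen ((Fin n → ℤ) × (Fin n → ℤ))),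
      (∀ g ∈ l, g.IsAdmissible (hyperbolicSum n) (Pi.single j 1, 0) (0, Pi.single j 1)) ∧
      ∀ v, UGen.eval (hyperbolicSum n) (Pi.single i 1, 0) (0, Pi.single i 1) L v =
        UGen.eval (hyperbolicSum n) (Pi.single j 1, 0) (0, Pi.single j 1) l v := by
  have hS := UGen.evalEquiv_mem_stableSpecialOrthogonal (isSymm_hyperbolicSum n) (isUnimodular_hyperbolicSum n).nondegenerate
    (hyperbolicSum_inl_inl n (Pi.single i 1) (Pi.single i 1)) (hyperbolicSum_inr_inr n (Pi.single i 1) (Pi.single i 1)) L hL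
  obtain ⟨l, hl, hlv⟩ :=
    hyperbolicSum_exists_uGens_eq_of_isOrientationPreserving_of_det_eq_one_of_two_le hn j _ hS.2.1 hS.2.2
  exact ⟨l, hl, fun v ↦ by rw [← hlv, UGen.evalEquiv_apply]⟩

end TwoLe

/-! ### §3 Every lattice isometric to `U^{⊕n}`, `n ≥ 2`, at every hyperbolic pair; the genus `II_{n,n}` -/

section Model

variable {W' : Type} [AddCommGroup W'] [Module.Finite ℤ W'] [Module.Free ℤ W'] {B' : BilinForm ℤ W'}

/-- **`SO⁺(L) = E_U(L₁)` for every `L ≅ U^{⊕n}`, `n ≥ 2`, and every splitting `L = U ⊕ L₁`**: every isometry of `(W′,B′) ≅ U^{⊕n}`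
in `O⁺` with determinant `1` is an admissible word in the transvections at ANY hyperbolic pair `(u, z)` of `W′`.
[cite: GritsenkoHulekSankaran2009, §3.2 Lemma 3.2 (14), Prop. 3.4 (15) and Prop. 3.3 (iii)] -/
theorem exists_uGens_eq_of_isOrientationPreserving_of_det_eq_one_of_isometryEquiv_hyperbolicSum_of_two_le {n : ℕ}
    (hn : 2 ≤ n) (e : (hyperbolicSum n).IsometryEquiv B') {u z : W'} (hu : B' u u = 0) (huz : B' u z = 1) (hz : B' z z = 0)
    (φ' : B'.IsometryEquiv B') (h₁ : φ'.IsOrientationPreserving) (h₂ : LinearMap.det (φ' : W' →ₗ[ℤ] W') = 1) :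
    ∃ l : List (UGen W'), (∀ g ∈ l, g.IsAdmissible B' u z) ∧ ∀ v, φ' v = UGen.eval B' u z l v := by
  have hi : (⟨0, by omega⟩ : Fin n) ≠ ⟨1, by omega⟩ := by simp [Fin.ext_iff]
  have hu' : hyperbolicSum n (e.symm u) (e.symm u) = 0 := by rw [e.symm.map_app, hu]
  have huz' : hyperbolicSum n (e.symm u) (e.symm z) = 1 := by rw [e.symm.map_app, huz]
  have hz' : hyperbolicSum n (e.symm z) (e.symm z) = 0 := by rw [e.symm.map_app, hz]
  obtain ⟨g, hgu, hgz⟩ := hyperbolicSum_exists_isometryEquiv_apply_eq_single hi hu' huz' hz'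
  have hx : (g.symm.trans e) (Pi.single (⟨0, by omega⟩ : Fin n) 1, 0) = u := by
    rw [LinearMap.BilinForm.IsometryEquiv.trans_apply, ← hgu, LinearMap.BilinForm.IsometryEquiv.symm_apply_apply,
      LinearMap.BilinForm.IsometryEquiv.apply_symm_apply]
  have hy : (g.symm.trans e) (0, Pi.single (⟨0, by omega⟩ : Fin n) 1) = z := by
    rw [LinearMap.BilinForm.IsometryEquiv.trans_apply, ← hgz, LinearMap.BilinForm.IsometryEquiv.symm_apply_apply,
      LinearMap.BilinForm.IsometryEquiv.apply_symm_apply]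
  obtain ⟨l, hl, hlv⟩ := exists_uGens_eq_of_isometryEquiv_of_forall (g.symm.trans e)
    (hyperbolicSum_exists_uGens_eq_of_isOrientationPreserving_of_det_eq_one_of_two_le hn ⟨0, by omega⟩) φ' h₁ h₂
  rw [hx, hy] at hl hlv
  exact ⟨l, hl, hlv⟩

/-- **`SO⁺(L) = E_U(L₁)` as an iff, for every `L ≅ U^{⊕n}`, `n ≥ 2`, at every hyperbolic pair.**
[cite: GritsenkoHulekSankaran2009, §3.2 (14), Prop. 3.4 (15) and §3.1 (8)] -/
theorem isOrientationPreserving_and_det_eq_one_iff_exists_uGens_of_isometryEquiv_hyperbolicSum_of_two_le {n : ℕ}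
    (hn : 2 ≤ n) (hB' : B'.IsSymm) (hnd' : B'.Nondegenerate) (e : (hyperbolicSum n).IsometryEquiv B') {u z : W'}
    (hu : B' u u = 0) (huz : B' u z = 1) (hz : B' z z = 0) (φ' : B'.IsometryEquiv B') :
    (φ'.IsOrientationPreserving ∧ LinearMap.det (φ' : W' →ₗ[ℤ] W') = 1) ↔
      ∃ (L : List (UGen W')) (hL : ∀ g ∈ L, g.IsAdmissible B' u z), φ' = UGen.evalEquiv hB' hu hz L hL := by
  constructor
  · rintro ⟨h₁, h₂⟩
    obtain ⟨L, hL, hφ⟩ := exists_uGens_eq_of_isOrientationPreserving_of_det_eq_one_of_isometryEquiv_hyperbolicSum_of_two_le hn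
      e hu huz hz φ' h₁ h₂
    exact ⟨L, hL, DFunLike.ext _ _ fun v ↦ by rw [hφ, UGen.evalEquiv_apply]⟩
  · rintro ⟨L, hL, rfl⟩
    exact (UGen.evalEquiv_mem_stableSpecialOrthogonal hB' hnd' hu hz L hL).2

variable {W : Type} [AddCommGroup W] [Module.Finite ℤ W] [Module.Free ℤ W] {B : BilinForm ℤ W}

/-- **`SO⁺ = E_{⟨u,z⟩}` for the genus `II_{n,n}`, `n ≥ 2`**: for every even unimodular lattice of rank `2n ≥ 4` and signature `0` and
every hyperbolic pair `(u, z)` in it, an isometry lies in `O⁺` with determinant `1` iff it is an admissible word in the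
transvections at `(u, z)`. [cite: GritsenkoHulekSankaran2009, §3.2 (14) and Prop. 3.4 (15)] [cite: Huybrechts2016K3, Ch. 14 Cor. 1.3 (i)] -/
theorem isOrientationPreserving_and_det_eq_one_iff_exists_uGens_of_isUnimodular_of_isEven_of_two_le (hB : B.IsSymm)
    (hU : B.IsUnimodular) (he : B.IsEven) {n : ℕ} (hn : 2 ≤ n) (hrank : finrank ℤ W = 2 * n) (hsig : B.signature = 0)
    {u z : W} (hu : B u u = 0) (huz : B u z = 1) (hz : B z z = 0) (φ : B.IsometryEquiv B) :
    (φ.IsOrientationPreserving ∧ LinearMap.det (φ : W →ₗ[ℤ] W) = 1) ↔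
      ∃ (L : List (UGen W)) (hL : ∀ g ∈ L, g.IsAdmissible B u z), φ = UGen.evalEquiv hB hu hz L hL := by
  obtain ⟨e⟩ := equivalent_hyperbolicSum_of_signature_eq_zero _ hB hU he (by omega) hrank hsig
  exact isOrientationPreserving_and_det_eq_one_iff_exists_uGens_of_isometryEquiv_hyperbolicSum_of_two_le hn hB hU.nondegenerate
    e.symm hu huz hz φ

end Model

end Literature.Topology.FourManifolds

end
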